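import Mathlib.Data.Nat.Choose.Dvd
import Summits.MatrixMultiplication.OmegaCensus.HeisenbergClassification
import Summits.MatrixMultiplication.OmegaCensus.MetacyclicRedeiM

/-!
# ω-census, family (b3): conjecture C9 on odd `p`-groups — word identities with central commutators; `He_p` and `M_p(m,1)` embed from generators

HONEST FRAMING (pub-omega census; verbatim): lottery ticket; floor = certified bounds/negative ranges.
Census BOOKKEEPING (conjecture C9 of the cell; pub-omega kernel-l4 gen 14, task K-3: the classification-free theorem «a non-abelian finite
`p`-group, `p` odd, is not box-useful», file 1 of 3).  Elementary group words, all with PROVED identities (no `decide`):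
* `conj_pow_eq_pow_pow`: `h g h⁻¹ = g^u ⇒ h^t g h^{-t} = g^{u^t}`; `conj_pow_eq_pow_mul`: `⇒ h g^j h⁻¹ = g^{j u}`;
* `pow_mul_eq_of_comm_central` / `pow_mul_pow_eq_of_comm_central`: if `z = y x y⁻¹ x⁻¹` is central then `y^a x = z^a x y^a` and
  `y^a x^b = z^{ab} x^b y^a` (bilinearity of a central commutator); `comm_pow_left`: `y^a x y^{-a} x⁻¹ = z^a`;
* `mul_pow_eq_of_comm_central`: `(x y)^n = x^n y^n d^{C(n,2)}` for the central commutator `d = y⁻¹ x⁻¹ y x` (Hall's formula in class `2`),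
  hence `mul_pow_prime_of_comm_central`: `(x y)^p = x^p y^p` when moreover `d^p = 1` and `p ≥ 3` is prime (`p ∣ C(p,2)`);
* **`heisHom` / `heisHom_injective`**: elements `x, y` with `x^p = y^p = 1` whose commutator `z = y x y⁻¹ x⁻¹ ≠ 1` is central generate a
  faithful copy of the Heisenberg group: `Heis p →* G`, `(a, b, c) ↦ x^b y^a z^c`; so `not_boxUseful_of_heis_generators` (`p ≥ 3` prime;
  `Heis.not_boxUseful_of_injective_heis'`);
* **`mmetaHom` / `mmetaHom_injective`**: `g` of order `p^m` (`m ≥ 2`) and `h ∉ ⟨g⟩` with `h^p = 1`, `h g h⁻¹ = g^{1+p^{m-1}}` generate a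
  faithful copy of `M_p(m,1)`: `Mmeta p m →* G`, `(t, x) ↦ g^x h^t`; so `not_boxUseful_of_mmeta_generators` (odd prime `p`;
  `Mcube.not_boxUseful_mmeta`, `BoxUseful.of_injective`).
Files 2–3 (`BoxBadOddPGroupsMinimal`, `BoxBadOddPGroups`) produce such generators inside a minimal counterexample.  Nothing here is
progress on `ω`.
-/

namespace Summit.MatrixMultiplication.OmegaCensus

open Finset ProductBoxBound

namespace OddPGroup

variable {G : Type*} [Group G]

/-! ### Word identities -/

/-- A central element commutes with everything (pointwise form of `Subgroup.mem_center_iff`). [folklore] -/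
theorem central_comm {z : G} (hz : z ∈ Subgroup.center G) (w : G) : w * z = z * w :=
  Subgroup.mem_center_iff.mp hz w

/-- If `h g h⁻¹ = g^u` then `h^t g h^{-t} = g^{u^t}`. [folklore] -/
theorem conj_pow_eq_pow_pow {g h : G} {u : ℕ} (hc : h * g * h⁻¹ = g ^ u) (t : ℕ) :
    h ^ t * g * (h ^ t)⁻¹ = g ^ (u ^ t) := by
  induction t with
  | zero => simp
  | succ t ih =>
    have e1 : h ^ (t + 1) * g * (h ^ (t + 1))⁻¹ = h * (h ^ t * g * (h ^ t)⁻¹) * h⁻¹ := by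
      rw [pow_succ' h t]; group
    rw [e1, ih, ← conj_pow, hc, ← pow_mul, ← pow_succ']

/-- Conjugation multiplies exponents: `h g h⁻¹ = g^u ⇒ h g^j h⁻¹ = g^{j u}`. [folklore] -/
theorem conj_pow_eq_pow_mul {g h : G} {u : ℕ} (hc : h * g * h⁻¹ = g ^ u) (j : ℕ) :
    h * g ^ j * h⁻¹ = g ^ (j * u) := by
  rw [← conj_pow, hc, ← pow_mul, mul_comm]

/-- With `z = y x y⁻¹ x⁻¹` central: `y^a x = z^a x y^a`. [folklore] -/
theorem pow_mul_eq_of_comm_central {x y : G} (hz : y * x * y⁻¹ * x⁻¹ ∈ Subgroup.center G) (a : ℕ) :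
    y ^ a * x = (y * x * y⁻¹ * x⁻¹) ^ a * x * y ^ a := by
  induction a with
  | zero => simp
  | succ a ih =>
    have hzy : y * (y * x * y⁻¹ * x⁻¹) ^ a = (y * x * y⁻¹ * x⁻¹) ^ a * y :=
      central_comm (Subgroup.pow_mem _ hz a) y
    calc y ^ (a + 1) * x = y * (y ^ a * x) := by rw [pow_succ']; group
      _ = y * ((y * x * y⁻¹ * x⁻¹) ^ a * x * y ^ a) := by rw [ih]
      _ = (y * (y * x * y⁻¹ * x⁻¹) ^ a) * x * y ^ a := by group
      _ = ((y * x * y⁻¹ * x⁻¹) ^ a * y) * x * y ^ a := by rw [hzy]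
      _ = (y * x * y⁻¹ * x⁻¹) ^ a * ((y * x * y⁻¹ * x⁻¹) * x * y) * y ^ a := by group
      _ = (y * x * y⁻¹ * x⁻¹) ^ (a + 1) * x * y ^ (a + 1) := by rw [pow_succ, pow_succ]; group

/-- With `z = y x y⁻¹ x⁻¹` central: `y^a x^b = z^{ab} x^b y^a` (bilinearity of a central commutator). [folklore] -/
theorem pow_mul_pow_eq_of_comm_central {x y : G} (hz : y * x * y⁻¹ * x⁻¹ ∈ Subgroup.center G) (a b : ℕ) :
    y ^ a * x ^ b = (y * x * y⁻¹ * x⁻¹) ^ (a * b) * x ^ b * y ^ a := by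
  induction b with
  | zero => simp
  | succ b ih =>
    have hzx : x ^ b * (y * x * y⁻¹ * x⁻¹) ^ a = (y * x * y⁻¹ * x⁻¹) ^ a * x ^ b :=
      central_comm (Subgroup.pow_mem _ hz a) (x ^ b)
    calc y ^ a * x ^ (b + 1) = (y ^ a * x ^ b) * x := by rw [pow_succ, mul_assoc]
      _ = (y * x * y⁻¹ * x⁻¹) ^ (a * b) * x ^ b * (y ^ a * x) := by rw [ih]; group
      _ = (y * x * y⁻¹ * x⁻¹) ^ (a * b) * x ^ b * ((y * x * y⁻¹ * x⁻¹) ^ a * x * y ^ a) := by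
          rw [pow_mul_eq_of_comm_central hz a]
      _ = (y * x * y⁻¹ * x⁻¹) ^ (a * b) * (x ^ b * (y * x * y⁻¹ * x⁻¹) ^ a) * x * y ^ a := by group
      _ = (y * x * y⁻¹ * x⁻¹) ^ (a * b) * ((y * x * y⁻¹ * x⁻¹) ^ a * x ^ b) * x * y ^ a := by rw [hzx]
      _ = (y * x * y⁻¹ * x⁻¹) ^ (a * (b + 1)) * x ^ (b + 1) * y ^ a := by
          rw [mul_add, mul_one, pow_add, pow_succ]; group

/-- With `z = y x y⁻¹ x⁻¹` central: the commutator of `y^a` and `x` is `z^a`. [folklore] -/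
theorem comm_pow_left {x y : G} (hz : y * x * y⁻¹ * x⁻¹ ∈ Subgroup.center G) (a : ℕ) :
    y ^ a * x * (y ^ a)⁻¹ * x⁻¹ = (y * x * y⁻¹ * x⁻¹) ^ a := by
  rw [pow_mul_eq_of_comm_central hz a]; group

/-- With `d = y⁻¹ x⁻¹ y x` central: `y^m x = x y^m d^m`. [folklore] -/
theorem pow_mul_eq_of_comm_central' {x y : G} (hd : y⁻¹ * x⁻¹ * y * x ∈ Subgroup.center G) (m : ℕ) :
    y ^ m * x = x * y ^ m * (y⁻¹ * x⁻¹ * y * x) ^ m := by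
  obtain ⟨d, hdd⟩ : ∃ d, d = y⁻¹ * x⁻¹ * y * x := ⟨_, rfl⟩
  have hyx : y * x = x * y * d := by rw [hdd]; group
  rw [← hdd] at hd ⊢
  induction m with
  | zero => simp
  | succ m ih =>
    calc y ^ (m + 1) * x = y * (y ^ m * x) := by rw [pow_succ']; group
      _ = y * (x * y ^ m * d ^ m) := by rw [ih]
      _ = (y * x) * y ^ m * d ^ m := by group
      _ = (x * y * d) * y ^ m * d ^ m := by rw [hyx]
      _ = x * y * (d * y ^ m) * d ^ m := by group
      _ = x * y * (y ^ m * d) * d ^ m := by rw [central_comm hd (y ^ m)]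
      _ = x * y ^ (m + 1) * d ^ (m + 1) := by rw [pow_succ' y m, pow_succ d m]; group

/-- **Hall's formula in class `2`.** With the commutator `d = y⁻¹ x⁻¹ y x` central: `(x y)^n = x^n y^n d^{C(n,2)}`. [folklore] -/
theorem mul_pow_eq_of_comm_central {x y : G} (hd : y⁻¹ * x⁻¹ * y * x ∈ Subgroup.center G) (n : ℕ) :
    (x * y) ^ n = x ^ n * y ^ n * (y⁻¹ * x⁻¹ * y * x) ^ (n.choose 2) := by
  induction n with
  | zero => simp
  | succ n ih =>
    have hc : y * (y⁻¹ * x⁻¹ * y * x) ^ n = (y⁻¹ * x⁻¹ * y * x) ^ n * y :=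
      central_comm (Subgroup.pow_mem _ hd n) y
    have hcT : (x * y) * (y⁻¹ * x⁻¹ * y * x) ^ (n.choose 2) = (y⁻¹ * x⁻¹ * y * x) ^ (n.choose 2) * (x * y) :=
      central_comm (Subgroup.pow_mem _ hd _) (x * y)
    calc (x * y) ^ (n + 1) = (x * y) ^ n * (x * y) := pow_succ _ _
      _ = x ^ n * y ^ n * (y⁻¹ * x⁻¹ * y * x) ^ (n.choose 2) * (x * y) := by rw [ih]
      _ = x ^ n * y ^ n * ((y⁻¹ * x⁻¹ * y * x) ^ (n.choose 2) * (x * y)) := by group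
      _ = x ^ n * y ^ n * ((x * y) * (y⁻¹ * x⁻¹ * y * x) ^ (n.choose 2)) := by rw [hcT]
      _ = x ^ n * (y ^ n * x) * y * (y⁻¹ * x⁻¹ * y * x) ^ (n.choose 2) := by group
      _ = x ^ n * (x * y ^ n * (y⁻¹ * x⁻¹ * y * x) ^ n) * y * (y⁻¹ * x⁻¹ * y * x) ^ (n.choose 2) := by
          rw [pow_mul_eq_of_comm_central' hd n]
      _ = x ^ (n + 1) * y ^ n * ((y⁻¹ * x⁻¹ * y * x) ^ n * y) * (y⁻¹ * x⁻¹ * y * x) ^ (n.choose 2) := by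
          rw [pow_succ]; group
      _ = x ^ (n + 1) * y ^ n * (y * (y⁻¹ * x⁻¹ * y * x) ^ n) * (y⁻¹ * x⁻¹ * y * x) ^ (n.choose 2) := by rw [hc]
      _ = x ^ (n + 1) * y ^ (n + 1) * (y⁻¹ * x⁻¹ * y * x) ^ ((n + 1).choose 2) := by
          rw [Nat.choose_succ_succ' n 1, Nat.choose_one_right, pow_add, pow_succ y n]; group

/-- **`(x y)^p = x^p y^p` for a prime `p ≥ 3`** when the commutator `d = y⁻¹ x⁻¹ y x` is central with `d^p = 1` (`p ∣ C(p,2)`). [folklore] -/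
theorem mul_pow_prime_of_comm_central {p : ℕ} (hp : p.Prime) (h3 : 3 ≤ p) {x y : G}
    (hd : y⁻¹ * x⁻¹ * y * x ∈ Subgroup.center G) (hdp : (y⁻¹ * x⁻¹ * y * x) ^ p = 1) :
    (x * y) ^ p = x ^ p * y ^ p := by
  rw [mul_pow_eq_of_comm_central hd p]
  obtain ⟨q, hq⟩ := Nat.Prime.dvd_choose_self hp (k := 2) (by norm_num) (by omega)
  rw [hq, pow_mul, hdp, one_pow, mul_one]

/-- Powers with exponents read in `ZMod n` are additive on an element killed by `n`. [folklore] -/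
theorem pow_val_add {n : ℕ} [NeZero n] {g : G} (hg : g ^ n = 1) (a b : ZMod n) :
    g ^ (a + b).val = g ^ a.val * g ^ b.val := by
  rw [ZMod.val_add, ← pow_eq_pow_mod _ hg, pow_add]

/-- `g^{(k : ZMod n).val} = g^k` on an element killed by `n`. [folklore] -/
theorem pow_val_natCast {n : ℕ} [NeZero n] {g : G} (hg : g ^ n = 1) (k : ℕ) :
    g ^ (k : ZMod n).val = g ^ k := by
  rw [ZMod.val_natCast, ← pow_eq_pow_mod _ hg]

/-! ### The Heisenberg group from two generators -/

section Heisenberg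

variable {p : ℕ} {x y : G}

/-- The Heisenberg word identity: `(x^b y^a z^c)(x^{b'} y^{a'} z^{c'}) = x^{b+b'} y^{a+a'} z^{c+c'+ab'}` for the central commutator
`z = y x y⁻¹ x⁻¹`. [folklore] -/
theorem heis_word_mul (hz : y * x * y⁻¹ * x⁻¹ ∈ Subgroup.center G) (a b c a' b' c' : ℕ) :
    x ^ b * y ^ a * (y * x * y⁻¹ * x⁻¹) ^ c * (x ^ b' * y ^ a' * (y * x * y⁻¹ * x⁻¹) ^ c') =
      x ^ b * x ^ b' * (y ^ a * y ^ a') *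
        ((y * x * y⁻¹ * x⁻¹) ^ c * (y * x * y⁻¹ * x⁻¹) ^ c' * (y * x * y⁻¹ * x⁻¹) ^ (a * b')) := by
  obtain ⟨z, hzdef⟩ : ∃ z, z = y * x * y⁻¹ * x⁻¹ := ⟨_, rfl⟩
  have hswap : y ^ a * x ^ b' = (y * x * y⁻¹ * x⁻¹) ^ (a * b') * x ^ b' * y ^ a :=
    pow_mul_pow_eq_of_comm_central hz _ _
  rw [← hzdef] at hz hswap ⊢
  have cz : ∀ (k : ℕ) (w : G), w * z ^ k = z ^ k * w := fun k w => central_comm (Subgroup.pow_mem _ hz k) w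
  calc x ^ b * y ^ a * z ^ c * (x ^ b' * y ^ a' * z ^ c')
      = x ^ b * y ^ a * (z ^ c * (x ^ b' * y ^ a' * z ^ c')) := by group
    _ = x ^ b * y ^ a * ((x ^ b' * y ^ a' * z ^ c') * z ^ c) := by rw [cz c (x ^ b' * y ^ a' * z ^ c')]
    _ = x ^ b * (y ^ a * x ^ b') * y ^ a' * z ^ c' * z ^ c := by group
    _ = x ^ b * (z ^ (a * b') * x ^ b' * y ^ a) * y ^ a' * z ^ c' * z ^ c := by rw [hswap]
    _ = x ^ b * (z ^ (a * b') * (x ^ b' * y ^ a * y ^ a' * z ^ c' * z ^ c)) := by group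
    _ = x ^ b * ((x ^ b' * y ^ a * y ^ a' * z ^ c' * z ^ c) * z ^ (a * b')) := by
        rw [cz (a * b') (x ^ b' * y ^ a * y ^ a' * z ^ c' * z ^ c)]
    _ = _ := by group

variable [NeZero p]

/-- **`He_p` from generators**: `x^p = y^p = 1`, `z = y x y⁻¹ x⁻¹` central ⇒ `(a, b, c) ↦ x^b y^a z^c` is a homomorphism
`Heis p →* G` (the law `(a,b,c)(a',b',c') = (a+a', b+b', c+c'+ab')` is `heis_word_mul`). [folklore] -/
def heisHom (hx : x ^ p = 1) (hy : y ^ p = 1) (hz : y * x * y⁻¹ * x⁻¹ ∈ Subgroup.center G) : Heis p →* G where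
  toFun v := x ^ v.b.val * y ^ v.a.val * (y * x * y⁻¹ * x⁻¹) ^ v.c.val
  map_one' := by simp [Heis.one_def]
  map_mul' v w := by
    have hzp : (y * x * y⁻¹ * x⁻¹) ^ p = 1 := by
      rw [← comm_pow_left hz p, hy]; group
    simp only [Heis.mul_def]
    rw [pow_val_add hx, pow_val_add hy, pow_val_add hzp, pow_val_add hzp, ZMod.val_mul, ← pow_eq_pow_mod _ hzp]
    exact (heis_word_mul hz _ _ _ _ _ _).symm

/-- The image of `(a, b, c)` under `heisHom`. [folklore] -/
theorem heisHom_apply (hx : x ^ p = 1) (hy : y ^ p = 1) (hz : y * x * y⁻¹ * x⁻¹ ∈ Subgroup.center G) (v : Heis p) :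
    heisHom hx hy hz v = x ^ v.b.val * y ^ v.a.val * (y * x * y⁻¹ * x⁻¹) ^ v.c.val := rfl

/-- **The copy of `He_p` is faithful** when the central commutator `z = y x y⁻¹ x⁻¹` is non-trivial (`p` prime): from a relation
`x^b y^a z^c = 1`, conjugating by `y` kills `b`, then conjugating by `x` kills `a`. [folklore] -/
theorem heisHom_injective [Fact p.Prime] (hx : x ^ p = 1) (hy : y ^ p = 1)
    (hz : y * x * y⁻¹ * x⁻¹ ∈ Subgroup.center G) (hz1 : y * x * y⁻¹ * x⁻¹ ≠ 1) :
    Function.Injective (heisHom hx hy hz) := by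
  rw [injective_iff_map_eq_one]
  intro v hv
  rw [heisHom_apply] at hv
  -- name the commutator
  obtain ⟨z, hzdef⟩ : ∃ z, z = y * x * y⁻¹ * x⁻¹ := ⟨_, rfl⟩
  have hzp : z ^ p = 1 := by rw [hzdef, ← comm_pow_left hz p, hy]; group
  have hyx : ∀ b : ℕ, y * x ^ b * y⁻¹ = z ^ b * x ^ b := fun b => by
    have := pow_mul_pow_eq_of_comm_central hz 1 b
    rw [pow_one, one_mul, ← hzdef] at this
    rw [this]; group
  have hya : ∀ a : ℕ, y ^ a * x = z ^ a * x * y ^ a := fun a => by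
    rw [pow_mul_eq_of_comm_central hz a, ← hzdef]
  rw [← hzdef] at hv hz hz1
  have cz : ∀ (k : ℕ) (w : G), w * z ^ k = z ^ k * w := fun k w => central_comm (Subgroup.pow_mem _ hz k) w
  have hoz : orderOf z = p := orderOf_eq_prime hzp hz1
  have val_eq_zero : ∀ {k : ℕ}, k < p → z ^ k = 1 → k = 0 := fun {k} hk h1 => by
    have hdvd : p ∣ k := by rw [← hoz]; exact orderOf_dvd_of_pow_eq_one h1
    exact Nat.eq_zero_of_dvd_of_lt hdvd hk
  -- conjugation by `y`
  have hb : v.b.val = 0 := by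
    apply val_eq_zero (ZMod.val_lt _)
    have e : y * (x ^ v.b.val * y ^ v.a.val * z ^ v.c.val) * y⁻¹ = z ^ v.b.val * (x ^ v.b.val * y ^ v.a.val * z ^ v.c.val) := by
      calc y * (x ^ v.b.val * y ^ v.a.val * z ^ v.c.val) * y⁻¹
          = (y * x ^ v.b.val * y⁻¹) * y ^ v.a.val * (y * z ^ v.c.val) * y⁻¹ := by group
        _ = (z ^ v.b.val * x ^ v.b.val) * y ^ v.a.val * (z ^ v.c.val * y) * y⁻¹ := by rw [hyx, cz v.c.val y]
        _ = z ^ v.b.val * (x ^ v.b.val * y ^ v.a.val * z ^ v.c.val) := by group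
    rw [hv] at e
    simpa using e.symm
  rw [hb, pow_zero, one_mul] at hv
  -- conjugation by `x`
  have ha : v.a.val = 0 := by
    apply val_eq_zero (ZMod.val_lt _)
    have hy' : y ^ v.a.val = (z ^ v.c.val)⁻¹ := eq_inv_of_mul_eq_one_left hv
    have e2 : y ^ v.a.val * x = x * y ^ v.a.val := by
      rw [hy']
      have := cz v.c.val x
      calc (z ^ v.c.val)⁻¹ * x = (z ^ v.c.val)⁻¹ * (x * z ^ v.c.val) * (z ^ v.c.val)⁻¹ := by group
        _ = (z ^ v.c.val)⁻¹ * (z ^ v.c.val * x) * (z ^ v.c.val)⁻¹ := by rw [this]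
        _ = x * (z ^ v.c.val)⁻¹ := by group
    have e3 : z ^ v.a.val * (x * y ^ v.a.val) = x * y ^ v.a.val := by
      rw [← mul_assoc, ← hya, e2]
    simpa using e3
  rw [ha, pow_zero, one_mul] at hv
  have hc : v.c.val = 0 := val_eq_zero (ZMod.val_lt _) hv
  apply Heis.ext
  · simpa [Heis.one_def] using (ZMod.val_eq_zero v.a).mp ha
  · simpa [Heis.one_def] using (ZMod.val_eq_zero v.b).mp hb
  · simpa [Heis.one_def] using (ZMod.val_eq_zero v.c).mp hc

/-- **Two elements of order `p` with non-trivial central commutator make `G` box-useless** (`p ≥ 3` prime): they generate a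
faithful copy of `He_p` (`heisHom`), which is not box-useful (`Heis.not_boxUseful_heis`), and box-uselessness passes to
overgroups. [folklore] -/
theorem not_boxUseful_of_heis_generators [Fintype G] [DecidableEq G] [Fact p.Prime] (h3 : 3 ≤ p) (hx : x ^ p = 1)
    (hy : y ^ p = 1) (hz : y * x * y⁻¹ * x⁻¹ ∈ Subgroup.center G) (hz1 : y * x * y⁻¹ * x⁻¹ ≠ 1) : ¬ BoxUseful G :=
  Heis.not_boxUseful_of_injective_heis' h3 (heisHom hx hy hz) (heisHom_injective hx hy hz hz1)

end Heisenberg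

/-! ### The metacyclic group `M_p(m,1)` from two generators -/

section Metacyclic

variable {p m : ℕ} {g h : G}

/-- `(1 + p^{m-1} e)^d = 1 + d e p^{m-1} + p^m·s` for some `s` (`m ≥ 2`: the square of `p^{m-1}` is divisible by `p^m`). [folklore] -/
theorem one_add_pow_pred_mul_pow (hm : 2 ≤ m) (e d : ℕ) :
    ∃ s : ℕ, (1 + p ^ (m - 1) * e) ^ d = 1 + d * e * p ^ (m - 1) + p ^ m * s := by
  induction d with
  | zero => exact ⟨0, by simp⟩
  | succ d ih =>
    obtain ⟨s, hs⟩ := ih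
    refine ⟨s + s * p ^ (m - 1) * e + p ^ (m - 2) * d * e * e, ?_⟩
    have hpm : p ^ (m - 1) * p ^ (m - 1) = p ^ m * p ^ (m - 2) := by
      rw [← pow_add, ← pow_add]; congr 1; omega
    rw [pow_succ, hs]
    have : (1 + d * e * p ^ (m - 1) + p ^ m * s) * (1 + p ^ (m - 1) * e) =
        1 + (d + 1) * e * p ^ (m - 1) + p ^ m * s + p ^ m * (s * p ^ (m - 1) * e) + d * e * e * (p ^ (m - 1) * p ^ (m - 1)) := by
      ring
    rw [this, hpm]
    ring

/-- The metacyclic word identity: with `g^{p^m} = 1`, `h g h⁻¹ = g^{1+p^{m-1}}` (`m ≥ 2`):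
`(g^x h^t)(g^{x'} h^{t'}) = g^x g^{x'} g^{p^{m-1} t x'} (h^t h^{t'})`. [folklore] -/
theorem mmeta_word_mul (hm : 2 ≤ m) (hg : g ^ p ^ m = 1) (hc : h * g * h⁻¹ = g ^ (1 + p ^ (m - 1))) (x t x' t' : ℕ) :
    g ^ x * h ^ t * (g ^ x' * h ^ t') = g ^ x * g ^ x' * g ^ (p ^ (m - 1) * t * x') * (h ^ t * h ^ t') := by
  have hconj : h ^ t * g ^ x' = g ^ (x' * (1 + p ^ (m - 1)) ^ t) * h ^ t := by
    rw [← conj_pow_eq_pow_mul (conj_pow_eq_pow_pow hc t) x']; group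
  obtain ⟨s, hs⟩ := one_add_pow_pred_mul_pow (p := p) hm 1 t
  simp only [mul_one] at hs
  have hexp : g ^ (x' * (1 + p ^ (m - 1)) ^ t) = g ^ x' * g ^ (p ^ (m - 1) * t * x') := by
    rw [hs, show x' * (1 + t * p ^ (m - 1) + p ^ m * s) = x' + p ^ (m - 1) * t * x' + p ^ m * (s * x') by ring,
      pow_add, pow_add, pow_mul g (p ^ m) (s * x'), hg, one_pow, mul_one]
  calc g ^ x * h ^ t * (g ^ x' * h ^ t') = g ^ x * (h ^ t * g ^ x') * h ^ t' := by group
    _ = g ^ x * (g ^ (x' * (1 + p ^ (m - 1)) ^ t) * h ^ t) * h ^ t' := by rw [hconj]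
    _ = g ^ x * (g ^ x' * g ^ (p ^ (m - 1) * t * x') * h ^ t) * h ^ t' := by rw [hexp]
    _ = _ := by group

variable [NeZero p] [Fact (2 ≤ m)]

/-- **`M_p(m,1)` from generators**: `g^{p^m} = 1`, `h^p = 1`, `h g h⁻¹ = g^{1+p^{m-1}}` (`m ≥ 2`) ⇒ `(t, x) ↦ g^x h^t` is a homomorphism
`Mmeta p m →* G` (the law `(t,x)(t',x') = (t+t', x+x'+p^{m-1} t̂ x')` is `mmeta_word_mul`). [folklore] -/
def mmetaHom (hg : g ^ p ^ m = 1) (hh : h ^ p = 1) (hc : h * g * h⁻¹ = g ^ (1 + p ^ (m - 1))) : Mmeta p m →* G where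
  toFun v := g ^ v.x.val * h ^ v.t.val
  map_one' := by simp [Mmeta.one_def]
  map_mul' v w := by
    have hm : 2 ≤ m := Fact.out
    have hQ : Mmeta.Q p m * Mmeta.L m v.t * w.x = ((p ^ (m - 1) * v.t.val * w.x.val : ℕ) : ZMod (p ^ m)) := by
      simp only [Mmeta.Q, Mmeta.L]; push_cast; rw [ZMod.natCast_zmod_val]
    simp only [Mmeta.mul_def]
    rw [pow_val_add hh, pow_val_add hg, pow_val_add hg, hQ, pow_val_natCast hg]
    exact (mmeta_word_mul hm hg hc _ _ _ _).symm

/-- The image of `(t, x)` under `mmetaHom`. [folklore] -/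
theorem mmetaHom_apply (hg : g ^ p ^ m = 1) (hh : h ^ p = 1) (hc : h * g * h⁻¹ = g ^ (1 + p ^ (m - 1))) (v : Mmeta p m) :
    mmetaHom hg hh hc v = g ^ v.x.val * h ^ v.t.val := rfl

/-- **The copy of `M_p(m,1)` is faithful** when `g` has order exactly `p^m`, `p` is prime and `h ∉ ⟨g⟩`: a relation `g^x h^t = 1` puts
`h^t` in `⟨g⟩`, so `p ∣ t` (else `h ∈ ⟨h^t⟩ ⊆ ⟨g⟩`), then `g^x = 1`. [folklore] -/
theorem mmetaHom_injective [Fact p.Prime] (hog : orderOf g = p ^ m) (hh : h ^ p = 1)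
    (hc : h * g * h⁻¹ = g ^ (1 + p ^ (m - 1))) (hng : h ∉ Subgroup.zpowers g) :
    Function.Injective (mmetaHom (hog ▸ pow_orderOf_eq_one g) hh hc) := by
  have hpri : p.Prime := Fact.out
  have h1 : h ≠ 1 := fun e => hng (e ▸ Subgroup.one_mem _)
  have hoh : orderOf h = p := orderOf_eq_prime hh h1
  rw [injective_iff_map_eq_one]
  intro v hv
  rw [mmetaHom_apply] at hv
  -- `h^t ∈ ⟨g⟩`
  have hmem : h ^ v.t.val ∈ Subgroup.zpowers g := by
    have : h ^ v.t.val = (g ^ v.x.val)⁻¹ := eq_inv_of_mul_eq_one_right hv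
    rw [this]
    exact Subgroup.inv_mem _ (Subgroup.pow_mem _ (Subgroup.mem_zpowers g) _)
  have ht : v.t.val = 0 := by
    by_contra ht0
    have hcop : (v.t.val).Coprime (orderOf h) := by
      rw [hoh]; exact (Nat.coprime_of_lt_prime ht0 (ZMod.val_lt v.t) hpri).symm
    obtain ⟨k, hk⟩ := exists_pow_eq_self_of_coprime hcop
    exact hng (hk ▸ Subgroup.pow_mem _ hmem k)
  rw [ht, pow_zero, mul_one] at hv
  have hdvd : p ^ m ∣ v.x.val := by
    have := orderOf_dvd_of_pow_eq_one hv
    rwa [hog] at this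
  have hx : v.x.val = 0 := Nat.eq_zero_of_dvd_of_lt hdvd (ZMod.val_lt v.x)
  apply Mmeta.ext
  · simpa [Mmeta.one_def] using (ZMod.val_eq_zero v.t).mp ht
  · simpa [Mmeta.one_def] using (ZMod.val_eq_zero v.x).mp hx

/-- **A faithful `M_p(m,1)` inside `G` makes `G` box-useless** (odd prime `p`, `m ≥ 2`): `g` of order `p^m`, `h ∉ ⟨g⟩` of order `p` with
`h g h⁻¹ = g^{1+p^{m-1}}` (`Mcube.not_boxUseful_mmeta` + `BoxUseful.of_injective`). [folklore] -/
theorem not_boxUseful_of_mmeta_generators [Fintype G] [DecidableEq G] [Fact p.Prime] (hodd : Odd p) (h3 : 3 ≤ p)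
    (hog : orderOf g = p ^ m) (hh : h ^ p = 1) (hc : h * g * h⁻¹ = g ^ (1 + p ^ (m - 1))) (hng : h ∉ Subgroup.zpowers g) :
    ¬ BoxUseful G := fun hG =>
  Mcube.not_boxUseful_mmeta hodd h3 (BoxUseful.of_injective _ (mmetaHom_injective hog hh hc hng) hG)

end Metacyclic

end OddPGroup

end Summit.MatrixMultiplication.OmegaCensus
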